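import Mathlib
import Literature.NumberTheory.LFunctions.WeilOddGroundState
import Summits.RiemannHypothesis.RiemannHypothesis.Theorems.GroundBartaEvenWinsBeyondArchUpper78
import Summits.RiemannHypothesis.RiemannHypothesis.Theorems.WeilGroundStateGroundStateSimpleEvenCellTransfer
import HarnessLib

/-!
# The parity ladder beyond `log 2`: the cell `[39/50, 79/100]` from an odd-sector lower bound at `79/100`

Route WeilParity item `NoParityCrossing` (stmt-RiemannHypothesis-18085; stub `stub_tailSimpleEven`) ≡ GroundBarta rung 4
(`EvenWinsBeyondArch`, stmt-RiemannHypothesis-18807).  Pure logic, RH-free, no named facts.  Prover A (gen 3).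

With the landed U-side `trialUpper78 : ε(39/50) ≤ 1/(70·10¹²)`, the cell transfer
`GroundStateSimpleEven.weilWindowSimpleEven_on_cell_of_le` reduces the cell `[39/50, 79/100]` of the ladder to ONE odd-sector
lower bound `1/(70·10¹²) < L ≤ ε_od(79/100)` (the deflated Temple L-side at `b = 79/100`).  Combined with
`WeilWindowSimpleEven` on `(0, 39/50]` (taken as a hypothesis, to be discharged by the cell-4 closure) this gives
`WeilWindowSimpleEven` on `(0, 79/100]`.
-/

set_option linter.dupNamespace false

noncomputable section

open Set MeasureTheory

namespace Summit.RiemannHypothesis.RiemannHypothesis.Theorems.EvenWinsBeyondArch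

open Literature.NumberTheory.LFunctions

/-- **The cell `[39/50, 79/100]`**: `1/(70·10¹²) < L ≤ ε_od(79/100) ⟹ WeilWindowSimpleEven a` for `a ∈ [39/50, 79/100]`. [folklore] -/
theorem weilWindowSimpleEven_on_cell_M79_of_oddLower {L : ℝ} (hUL : (1 / 70000000000000 : ℝ) < L)
    (hL : L ≤ weilOddGroundEnergy (79 / 100 : ℝ)) {a : ℝ} (hlo : (39 / 50 : ℝ) ≤ a) (hhi : a ≤ 79 / 100) :
    WeilWindowSimpleEven a :=
  GroundStateSimpleEven.weilWindowSimpleEven_on_cell_of_le (b := (39 / 50 : ℝ)) (c := (79 / 100 : ℝ)) (by norm_num) hUL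
    trialUpper78 (fun _ hg hs hn ho ↦ hL.trans (weilOddGroundEnergy_le hg hs ho hn)) hlo hhi

/-- **`WeilWindowSimpleEven` on `(0, 79/100]`** from `WeilWindowSimpleEven` on `(0, 39/50]` and the odd-sector lower bound
at `79/100`. [folklore] -/
theorem weilWindowSimpleEven_upTo_M79_of_oddLower (h78 : ∀ a : ℝ, 0 < a → a ≤ 39 / 50 → WeilWindowSimpleEven a)
    {L : ℝ} (hUL : (1 / 70000000000000 : ℝ) < L) (hL : L ≤ weilOddGroundEnergy (79 / 100 : ℝ)) :
    ∀ a : ℝ, 0 < a → a ≤ 79 / 100 → WeilWindowSimpleEven a := by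
  intro a ha hle
  rcases le_or_gt a (39 / 50) with h | h
  · exact h78 a ha h
  · exact weilWindowSimpleEven_on_cell_M79_of_oddLower hUL hL h.le hle

end Summit.RiemannHypothesis.RiemannHypothesis.Theorems.EvenWinsBeyondArch

end
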